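import Summits.CriticalPhenomena.PercolationContinuityZ3.Theorems.PercNearOneGluingNoHeavyLowerTailPatternLightestStarGlue
import Summits.CriticalPhenomena.PercolationContinuityZ3.Theorems.PercNearOneGluingNoHeavyLowerTailTieLocusCorner
import Summits.CriticalPhenomena.PercolationContinuityZ3.Theorems.PercNearOneGluingNoHeavyLowerTailMergeStability
import HarnessLib

/-!
# `NoHeavyLowerTail` (stmt-CriticalPhenomena-4575) — THE PATTERN-LIGHTEST BOUND FOR RELAY-NEIGHBOURED OBSERVERS

Support file (prover `prim-hp-8`, technique "tie/glue-locus exclusion"; `--supports stmt-CriticalPhenomena-4575`).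
No definitions, no named facts, no sorries.

**Theorem (`patternLightest_firstPort`).**  Bond percolation `μ = prodBernoulli v`, relays `A`, level `j`, an observer
`o ∉ A` all of whose positive-weight edges go to the relays `p 0, …, p (d−1)` (injective), listed so that for `l ≤ l'`
the port `p l` is at least as light-prone as `p l'` IN THE GRAPH WITH THE EDGES AT `o` REMOVED.  Then

  `μ(1 ≤ N ≤ j) ≤ Σ_l μ(the first open edge at o, in this order, is o–p l) · μ(|π(p l)| ≤ j)`,

`N = |π(o)|`: the observer's relay block is small and nonempty no more often than the expected lightness (in the graph
itself) of the most light-prone relay it is directly attached to.  This is the relay-neighboured case of the registered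
stub `stub_patternLightest` (PL), in the sharper `(G−o)`-order form; it refines `cil_relayNeighbours`
(`≤ max_l μ(|π(p l)| ≤ j)`) and gives `μ(1 ≤ N ≤ j) ≤ μ(o ↔ A) · max_l μ(|π(p l)| ≤ j)`.  PL is hypothesis-free (no
champion), so it has no tie locus; its equality locus is the glue locus.

Proof: induction on `d`.  One-bond decomposition in the top coin `e = o–p 0` (`TieLocus.real_oneBond`): with `u = v e`,
`μ(L) = (1−u) μ_{v[e↦0]}(L) + u μ_{v[e↦1]}(L)`, `μ_{v[e↦1]}(L) ≤ μ_{v[e↦1]}(R_{p 0})` (the observer is glued to `p 0`), the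
induction hypothesis for `v[e↦0]` and the ports `p ∘ succ` (same order, since the graph without the edges at `o` is
unchanged), and the first-port probabilities `μ(F_0) = u`, `μ(F_{l+1}) = (1−u) μ_{v[e↦0]}(F'_l)`.  The difference between the
two sides is then `u(1−u)·[loss(p 0) − Σ_l μ_{v[e↦0]}(F'_l)·loss(p (l+1))] ≥ 0` by `selfGluingLoss_ge_star` (part 2) and
`Σ_l μ(F'_l) ≤ 1`.  Memo with the paper proof: PROOF-PL-STAR.md (item evidence).
-/

noncomputable section

namespace Summit.CriticalPhenomena.PercolationContinuityZ3.Theorems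

namespace PatternLightestStar

open MeasureTheory Set Literature.Probability.LatticeModels Literature.Probability.Percolation
open scoped Classical

variable {n : ℕ}

/-! ### The pattern-lightest bound for relay-neighboured observers -/

/-- The first-open-port events are pairwise disjoint, so their probabilities sum to at most `1`. [folklore] -/
theorem sum_real_firstPort_le_one (μ : Measure (BondConfig (Fin n))) [IsProbabilityMeasure μ] {d : ℕ}
    (o : Fin n) (p : Fin d → Fin n) :
    ∑ l : Fin d, μ.real {ω : BondConfig (Fin n) | s(o, p l) ∈ ω ∧ ∀ i : Fin d, i < l → s(o, p i) ∉ ω} ≤ 1 := by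
  have hdisj : (↑(Finset.univ : Finset (Fin d)) : Set (Fin d)).PairwiseDisjoint
      (fun l => {ω : BondConfig (Fin n) | s(o, p l) ∈ ω ∧ ∀ i : Fin d, i < l → s(o, p i) ∉ ω}) := by
    intro l _ l' _ hll'
    rw [Function.onFun, Set.disjoint_left]
    rintro ω ⟨h1, h2⟩ ⟨h1', h2'⟩
    rcases lt_or_gt_of_ne hll' with h | h
    · exact h2' l h h1
    · exact h2 l' h h1'
  rw [← measureReal_biUnion_finset hdisj (fun l _ => (Set.toFinite _).measurableSet)]
  exact (measureReal_mono (subset_univ _) (measure_ne_top _ _)).trans (le_of_eq probReal_univ)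

/-- **The pattern-lightest bound for a relay-neighboured observer (first-open-port form).**  Let `o ∉ A` have all its
positive-weight edges going to the relays `p 0, …, p (d−1)` (injective), listed so that `l ≤ l'` implies that `p l` is at
least as light-prone as `p l'` IN THE GRAPH WITH THE EDGES AT `o` REMOVED.  Then
`μ(1 ≤ N ≤ j) ≤ Σ_l μ(the first open edge at o in this order is o–p l) · μ(|π(p l)| ≤ j)`:
the observer's block is small and nonempty no more often than the expected lightness of the best relay it touches.
It refines `cil_relayNeighbours` (whose conclusion is `≤ max_l μ(|π(p l)| ≤ j)`).  Proof: induction on `d` by the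
one-bond decomposition in the top coin `o–p 0`; the step is `selfGluingLoss_ge_star`.  (Memo PROOF-PL-STAR.md.) -/
theorem patternLightest_firstPort : ∀ {d : ℕ} (v : Sym2 (Fin n) → unitInterval) (A : Finset (Fin n)) (o : Fin n)
    (j : ℕ) (p : Fin d → Fin n), Function.Injective p → (∀ l, p l ∈ A) → o ∉ A →
    (∀ y : Fin n, v s(o, y) ≠ 0 → ∃ l, y = p l) →
    (∀ l l' : Fin d, l ≤ l' →
      (prodBernoulli fun e : Sym2 (Fin n) => if e ∈ {e : Sym2 (Fin n) | o ∉ e} then v e else 0).real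
          {ω : BondConfig (Fin n) | (A.filter fun z => ω ∈ openConn (p l') z).card ≤ j} ≤
        (prodBernoulli fun e : Sym2 (Fin n) => if e ∈ {e : Sym2 (Fin n) | o ∉ e} then v e else 0).real
          {ω : BondConfig (Fin n) | (A.filter fun z => ω ∈ openConn (p l) z).card ≤ j}) →
    (prodBernoulli v).real {ω : BondConfig (Fin n) |
        1 ≤ (A.filter fun z => ω ∈ openConn o z).card ∧ (A.filter fun z => ω ∈ openConn o z).card ≤ j} ≤
      ∑ l : Fin d, (prodBernoulli v).real
          {ω : BondConfig (Fin n) | s(o, p l) ∈ ω ∧ ∀ i : Fin d, i < l → s(o, p i) ∉ ω} *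
        (prodBernoulli v).real {ω : BondConfig (Fin n) | (A.filter fun z => ω ∈ openConn (p l) z).card ≤ j} := by
  intro d
  induction d with
  | zero =>
    intro v A o j p hp hpA hoA hobs hord
    rw [MergeStability.real_L_eq_zero_of_isolated v A o j hoA]
    · simp
    · intro y _
      by_contra h
      obtain ⟨l, _⟩ := hobs y (fun h' => h (by rw [h']; rfl))
      exact l.elim0
  | succ d ih =>
    intro v A o j p hp hpA hoA hobs hord
    set μ := prodBernoulli v with hμ
    set e : Sym2 (Fin n) := s(o, p 0) with he
    set v0 := Function.update v e 0 with hv0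
    set v1 := Function.update v e 1 with hv1
    set u0 : ℝ := (v e : ℝ) with hu0
    have hu0' : 0 ≤ u0 := (v e).2.1
    have hu1' : u0 ≤ 1 := (v e).2.2
    have hpo : ∀ l, p l ≠ o := fun l h => hoA (h ▸ hpA l)
    have hop : o ≠ p 0 := (hpo 0).symm
    -- events
    set L : Set (BondConfig (Fin n)) := {ω | 1 ≤ (A.filter fun z => ω ∈ openConn o z).card ∧
      (A.filter fun z => ω ∈ openConn o z).card ≤ j} with hL
    set R : Fin n → Set (BondConfig (Fin n)) := fun a => {ω | (A.filter fun z => ω ∈ openConn a z).card ≤ j} with hR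
    set F : Fin (d + 1) → Set (BondConfig (Fin n)) := fun l =>
      {ω | s(o, p l) ∈ ω ∧ ∀ i : Fin (d + 1), i < l → s(o, p i) ∉ ω} with hF
    set p' : Fin d → Fin n := fun l => p l.succ with hp'
    set F' : Fin d → Set (BondConfig (Fin n)) := fun l =>
      {ω | s(o, p' l) ∈ ω ∧ ∀ i : Fin d, i < l → s(o, p' i) ∉ ω} with hF'
    -- the restricted weights are the same for v and v0
    have hu : (fun f : Sym2 (Fin n) => if f ∈ {f : Sym2 (Fin n) | o ∉ f} then v0 f else 0) =
        fun f : Sym2 (Fin n) => if f ∈ {f : Sym2 (Fin n) | o ∉ f} then v f else 0 := by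
      funext f
      by_cases hf : f ∈ {f : Sym2 (Fin n) | o ∉ f}
      · have hfe : f ≠ e := by
          intro h'; apply hf; rw [h', he]; exact Sym2.mem_mk_left o (p 0)
        simp only [hf, if_true, hv0, Function.update_of_ne hfe]
      · simp only [hf, if_false]
    -- induction hypothesis for v0 and the ports p'
    have hp'inj : Function.Injective p' := fun a b h => Fin.succ_injective _ (hp h)
    have hIH := ih v0 A o j p' hp'inj (fun l => hpA _) hoA ?_ ?_
    rotate_left
    · intro y hy
      have hye : s(o, y) ≠ e := by
        intro h; apply hy; rw [h, hv0, Function.update_self]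
      rw [hv0, Function.update_of_ne hye] at hy
      obtain ⟨l, rfl⟩ := hobs y hy
      have hl0 : l ≠ 0 := by intro h; apply hye; rw [h]
      exact ⟨l.pred hl0, by simp [hp']⟩
    · intro l l' hll'
      rw [hu]
      exact hord l.succ l'.succ (Fin.succ_le_succ_iff.2 hll')
    -- (1) one-bond decompositions in the coin e
    have hLdec := TieLocus.real_oneBond v e L
    have hRdec : ∀ a, μ.real (R a) = (1 - u0) * (prodBernoulli v0).real (R a) + u0 * (prodBernoulli v1).real (R a) :=
      fun a => TieLocus.real_oneBond v e (R a)
    -- (2) under v1 the observer is glued to p 0: μ_{v1}(L) ≤ μ_{v1}(R (p 0))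
    have hL1 : (prodBernoulli v1).real L ≤ (prodBernoulli v1).real (R (p 0)) := by
      have hae : ∀ᵐ ω ∂(prodBernoulli v1), e ∈ ω :=
        prodBernoulli_ae_mem_of_eq_one v1 (by rw [hv1, Function.update_self])
      have h1 : (prodBernoulli v1).real L = (prodBernoulli v1).real (L ∩ {ω | e ∈ ω}) := by
        refine measureReal_congr (hae.mono fun ω hω => ?_)
        exact propext ⟨fun h => ⟨h, hω⟩, fun h => h.1⟩
      rw [h1]
      apply measureReal_mono _ (measure_ne_top _ _)
      rintro ω ⟨⟨-, hj⟩, hωe⟩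
      simp only [hR, mem_setOf_eq]
      have hreach : ω ∈ openConn o (p 0) := by
        change (openGraph ω).Reachable o (p 0)
        have : (openGraph ω).Adj o (p 0) := by
          rw [openGraph, SimpleGraph.fromEdgeSet_adj]; exact ⟨hωe, hop⟩
        exact this.reachable
      rw [TieLocus.filter_openConn_eq_of_mem A hreach]
      exact hj
    -- (3) the first-port probabilities
    have hF0 : μ.real (F 0) = u0 := by
      have : F 0 = {ω | e ∈ ω} := by
        ext ω
        simp only [hF, mem_setOf_eq, he]
        constructor
        · exact fun h => h.1
        · intro h; exact ⟨h, fun i hi => absurd hi (not_lt.2 (Fin.zero_le _))⟩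
      rw [this]
      exact prodBernoulli_real_setOf_mem v e
    have hFsucc : ∀ l : Fin d, μ.real (F l.succ) = (1 - u0) * (prodBernoulli v0).real (F' l) := by
      intro l
      rw [TieLocus.real_oneBond v e (F l.succ)]
      have h1 : (prodBernoulli v1).real (F l.succ) = 0 := by
        have hae : ∀ᵐ ω ∂(prodBernoulli v1), e ∈ ω :=
          prodBernoulli_ae_mem_of_eq_one v1 (by rw [hv1, Function.update_self])
        have : (prodBernoulli v1).real (F l.succ) = (prodBernoulli v1).real (∅ : Set (BondConfig (Fin n))) := by
          refine measureReal_congr (hae.mono fun ω hω => ?_)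
          have key : ω ∈ F l.succ ↔ ω ∈ (∅ : Set (BondConfig (Fin n))) :=
            ⟨fun h => (h.2 0 (Fin.succ_pos l) hω).elim, fun h => (Set.notMem_empty ω h).elim⟩
          exact propext key
        rw [this, measureReal_empty]
      have h0 : (prodBernoulli v0).real (F l.succ) = (prodBernoulli v0).real (F' l) := by
        have hae : ∀ᵐ ω ∂(prodBernoulli v0), e ∉ ω :=
          prodBernoulli_ae_notMem v0 (by rw [hv0, Function.update_self])
        refine measureReal_congr (hae.mono fun ω hω => ?_)
        have key : ω ∈ F l.succ ↔ ω ∈ F' l := by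
          change (s(o, p l.succ) ∈ ω ∧ ∀ i : Fin (d + 1), i < l.succ → s(o, p i) ∉ ω) ↔
            (s(o, p l.succ) ∈ ω ∧ ∀ i : Fin d, i < l → s(o, p i.succ) ∉ ω)
          constructor
          · rintro ⟨h1, h2⟩
            exact ⟨h1, fun i hi => h2 i.succ (Fin.succ_lt_succ_iff.2 hi)⟩
          · rintro ⟨h1, h2⟩
            refine ⟨h1, fun i hi => ?_⟩
            by_cases hi0 : i = 0
            · rw [hi0]; exact hω
            · have hlt : i.pred hi0 < l := by
                rw [← Fin.succ_lt_succ_iff, Fin.succ_pred]; exact hi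
              have := h2 (i.pred hi0) hlt
              rwa [Fin.succ_pred] at this
        exact propext key
      rw [h1, h0]; ring
    -- (4) the self-gluing step in v0
    have hv0e : v0 e = 0 := by rw [hv0, Function.update_self]
    have hv01 : Function.update v0 e 1 = v1 := by rw [hv0, hv1, Function.update_idem]
    have hobs0 : ∀ y : Fin n, v0 s(o, y) ≠ 0 → y ∈ A ∧
        (prodBernoulli fun f : Sym2 (Fin n) => if f ∈ {f : Sym2 (Fin n) | o ∉ f} then v0 f else 0).real (R y) ≤
        (prodBernoulli fun f : Sym2 (Fin n) => if f ∈ {f : Sym2 (Fin n) | o ∉ f} then v0 f else 0).real (R (p 0)) := by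
      intro y hy
      have hye : s(o, y) ≠ e := by
        intro h; apply hy; rw [h, hv0, Function.update_self]
      rw [hv0, Function.update_of_ne hye] at hy
      obtain ⟨l, rfl⟩ := hobs y hy
      refine ⟨hpA l, ?_⟩
      rw [hu]
      exact hord 0 l (Fin.zero_le _)
    have hTOP : ∀ l : Fin d, (prodBernoulli v0).real (R (p' l)) - (prodBernoulli v1).real (R (p' l)) ≤
        (prodBernoulli v0).real (R (p 0)) - (prodBernoulli v1).real (R (p 0)) := by
      intro l
      have := selfGluingLoss_ge_star v0 A j hoA (hpA 0) hv0e (hpo l.succ) hobs0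
      rw [hv01] at this
      exact this
    have hκ0 : 0 ≤ (prodBernoulli v0).real (R (p 0)) - (prodBernoulli v1).real (R (p 0)) := by
      have := loss_self_nonneg v0 A j hop hv0e
      rw [hv01] at this
      linarith
    -- (5) bookkeeping
    set M : ℝ := ∑ l : Fin d, (prodBernoulli v0).real (F' l) with hM
    set T0 : ℝ := ∑ l : Fin d, (prodBernoulli v0).real (F' l) * (prodBernoulli v0).real (R (p' l)) with hT0
    set T1 : ℝ := ∑ l : Fin d, (prodBernoulli v0).real (F' l) * (prodBernoulli v1).real (R (p' l)) with hT1
    have hM1 : M ≤ 1 := sum_real_firstPort_le_one (prodBernoulli v0) o p'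
    have hMT : T0 - T1 ≤ (prodBernoulli v0).real (R (p 0)) - (prodBernoulli v1).real (R (p 0)) := by
      have h1 : T0 - T1 = ∑ l : Fin d, (prodBernoulli v0).real (F' l) *
          ((prodBernoulli v0).real (R (p' l)) - (prodBernoulli v1).real (R (p' l))) := by
        rw [hT0, hT1, ← Finset.sum_sub_distrib]
        refine Finset.sum_congr rfl fun l _ => ?_
        ring
      have h2 : ∑ l : Fin d, (prodBernoulli v0).real (F' l) *
          ((prodBernoulli v0).real (R (p' l)) - (prodBernoulli v1).real (R (p' l))) ≤
          ∑ l : Fin d, (prodBernoulli v0).real (F' l) *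
          ((prodBernoulli v0).real (R (p 0)) - (prodBernoulli v1).real (R (p 0))) :=
        Finset.sum_le_sum fun l _ => mul_le_mul_of_nonneg_left (hTOP l) measureReal_nonneg
      rw [← Finset.sum_mul] at h2
      rw [h1]
      refine h2.trans ?_
      calc M * ((prodBernoulli v0).real (R (p 0)) - (prodBernoulli v1).real (R (p 0)))
          ≤ 1 * ((prodBernoulli v0).real (R (p 0)) - (prodBernoulli v1).real (R (p 0))) :=
            mul_le_mul_of_nonneg_right hM1 hκ0
        _ = _ := one_mul _
    -- the right-hand side, expanded
    have hRHS : ∑ l : Fin (d + 1), μ.real (F l) * μ.real (R (p l)) =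
        u0 * ((1 - u0) * (prodBernoulli v0).real (R (p 0)) + u0 * (prodBernoulli v1).real (R (p 0))) +
          ((1 - u0) * (1 - u0) * T0 + (1 - u0) * u0 * T1) := by
      rw [Fin.sum_univ_succ, hF0, hRdec (p 0)]
      congr 1
      have : ∀ l : Fin d, μ.real (F l.succ) * μ.real (R (p l.succ)) =
          (1 - u0) * (1 - u0) * ((prodBernoulli v0).real (F' l) * (prodBernoulli v0).real (R (p' l))) +
          (1 - u0) * u0 * ((prodBernoulli v0).real (F' l) * (prodBernoulli v1).real (R (p' l))) := by
        intro l
        rw [hFsucc l, hRdec (p l.succ)]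
        simp only [hp']
        ring
      rw [Finset.sum_congr rfl fun l _ => this l, Finset.sum_add_distrib, ← Finset.mul_sum, ← Finset.mul_sum]
    -- conclude
    rw [hRHS, hLdec]
    have hIH' : (prodBernoulli v0).real L ≤ T0 := hIH
    have hB : (1 - u0) * (prodBernoulli v0).real L ≤ (1 - u0) * T0 :=
      mul_le_mul_of_nonneg_left hIH' (by linarith)
    have hC : u0 * (prodBernoulli v1).real L ≤ u0 * (prodBernoulli v1).real (R (p 0)) :=
      mul_le_mul_of_nonneg_left hL1 hu0'
    nlinarith [mul_nonneg hu0' (sub_nonneg.2 hu1'), hMT, hB, hC]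

end PatternLightestStar

end Summit.CriticalPhenomena.PercolationContinuityZ3.Theorems

end
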